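import Summits.QuantumFields.BalabanUV.Beta.GAN24.NestedBackgroundWordRate
import Summits.QuantumFields.BalabanUV.T4Continuum.Support.ScalarAveragedPropagator
import Summits.QuantumFields.BalabanUV.T4Continuum.Support.GaugeTermCoercivity
import Literature.MathematicalPhysics.QuantumFieldTheory.Balaban1983to89.B5G183FreeRowSum

/-!
# `BalabanUV.Beta.GAN24.SlabSmoothingBound` — binder row G-an2-4 ∕ (CONV-C), routes C-R6° («VALUES») × R7 («TWO CURRENCIES»), PART 226:
# «A MASSIVE PROPAGATOR SMOOTHS SHEETS» — `‖𝒢^{(η)}·𝟙_{slab}‖ ≤ Cst(d,a)·√(3m·η)` FOR EVERY COORDINATE SLAB OF `m` FINE LAYERS, from (1.89)'s `‖𝒢‖, ‖∇_ν𝒢‖ ≤ Cst` alone and a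
# discrete trace (slab) inequality `Σ_{slab} |u|² ≤ m·(‖u‖²∕N_ν + 2‖S_νu − u‖·‖u‖)` — the support-sensitive operator letter that census V204′ (ii) (NON-nested bounded profiles, whose
# nesting defect `JᴴD′J − D` lives on thin coordinate slabs) asks for (unit b2b-balaban-gan24-p3, gen 64; v1)

NOT IN PRINT; OUR PROOF ([folklore] a discrete co-area ∕ trace inequality along one coordinate of a finite torus + [B5] (1.89) BY NAME (`B5Prop11Plancherel.opNorm_calG_le`,
`opNorm_fdiff_calG_le`, `calG_isHermitian`, `fdiff = n•(S_ν − 1)`); `ScalarAveragedPropagator.opNorm_le_of_nsq_le_rect`, `GaugeTermCoercivity.nsq_mulVec_le_rect`; [Balaban1984PropagatorsI]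
Prop. 1.1 (1.89) p. 33 is the only printed input; nothing printed is a hypothesis).
HONEST FRAMING (cell contract, verbatim): «discharging `BetaPertH` makes Bałaban's UV stability UNCONDITIONAL — a real constructive-QFT result; it is NOT the
continuum limit and NOT the Clay problem.»  HONEST DEPENDENCY (verbatim): «continuum YM on T⁴ ⇐ BetaPertH ∧ nine spine estimates (0/9 proved); BetaPertH ⇐
(D1) ∧ (D4) ∧ CAP+tail; G-an2-4 gates asym, D1 and NE2/3/4.»

WHY (census V204′ (ii)).  PART 217's planted word law passes a NESTED multiplier through King's pairing exactly (`JᴴD′J = D`).  For a bounded profile that is NOT a union of unit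
blocks (PART 213's `ρ ≤ 0` balls, half blocks, …) the block average `JᴴD′J` of the finer profile differs from the coarser one on a thin set — a few coordinate slabs of `O(1)` fine
layers — and the word law acquires the defect `J𝒢(JᴴD′J − D)WJᴴ` (PART 227).  Its operator norm is NOT small through `‖JᴴD′J − D‖` (a thin indicator has norm `1`); it is small because
`𝒢` SMOOTHS: a function `u = 𝒢g` has `‖u‖ ≤ Cst‖g‖` and `‖S_νu − u‖ = η‖∇_νu‖ ≤ η·Cst‖g‖`, and a function with small increments along `ν` cannot concentrate on a slab transverse
to `ν` — `Σ_{slab}|u|² ≤ m(‖u‖²∕N_ν + 2‖S_νu − u‖‖u‖) ≤ 3mη·Cst²‖g‖²`.  Hence `‖𝟙_{slab}𝒢‖ = ‖𝒢𝟙_{slab}‖ ≤ Cst√(3mη)`: geometric along the tower at ratio `√(L⁻¹)`.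

WHAT THIS FILE PROVES (0 sorry, 0 `def`; `X` any finite type, `σ` any permutation of `X`, `S ⊆ X`, `N ≥ 1`, `m` with `#{t < N : σ^{−t}v ∈ S} ≤ m` for all `v`):
* §1 THE ABSTRACT SLAB INEQUALITY: `normSq_le_orbit` (telescoping along the `σ`-orbit), `normSq_le_avg_orbit` (average over `t < N`), `sum_slab_orbit_le` (exchange of summations:
  `Σ_{w∈S}Σ_{t<N} h(σ^tw) ≤ m·Σ_v h v` for `h ≥ 0`), `sum_mul_le_sqrt_mul_sqrt` (Cauchy–Schwarz), `sum_abs_normSq_sub_le` (`Σ_v |‖u(σv)‖² − ‖u v‖²| ≤ 2‖u∘σ − u‖‖u‖`),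
  **`sum_slab_normSq_le`**: `Σ_{w∈S} ‖u w‖² ≤ m·(‖u‖²∕N + 2‖u∘σ − u‖·‖u‖)`.
* §2 THE TORUS SLAB: `X = Tor N × Fin d`, `σ = (· + e_ν, ·)` (the permutation is `Equiv.prodCongr (Equiv.addRight e_ν) 1` spelled out; `(S_νu)(w) = u(σw)` is `B5G183FreeRowSum.shiftM_mulVec`), `S = {w : w₁(ν) ∈ A}`:
  `prodShift_pow_apply`, `card_filter_shift_mem` (`#{t < N_ν : σ^{−t}v ∈ S} = #A`), **`nsq_slab_le`** (the slab inequality for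
  `u : Tor N × Fin d → ℂ` with `N = N_ν`, `m = #A`).
* §3 **`opNorm_slab_mul_calG_le`**, **`opNorm_calG_mul_slab_le`** — `‖𝟙_A·𝒢‖, ‖𝒢·𝟙_A‖ ≤ Cst(d,a)·√(3·#A∕n)` on the fine torus `Tor (fine n M) × Fin d` (`𝟙_A = diagonal [w₁(ν) ∈ A]`,
  `N_ν = n·M_ν ≥ n`); tower reading **`opNorm_calGlev_mul_slab_le`**: `‖𝒢_k·𝟙_A‖ ≤ Cst(d,a)·√(3·#A)·(√(L⁻¹))^k`.
WHAT IT DOES NOT DO: the defect word law (PART 227), the almost-nested tower rate and ENDs (PART 228), any profile's defect geometry.  SUPPLIER work; NEVER «G-an2-4 closed»;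
NOT (CONV-C), NOT D1, NOT `BetaPertH`, NOT continuum, NOT Clay.  Records: `HOME/b2b-balaban-gan24-p3/gen64/README.md`.
-/

noncomputable section

open scoped BigOperators ComplexConjugate Matrix Matrix.Norms.L2Operator
open Finset Matrix

namespace Summit.QuantumFields.BalabanUV.Beta.GAN24.SlabSmoothingBound

open Literature.MathematicalPhysics.QuantumFieldTheory.Balaban1983to89
open Literature.MathematicalPhysics.QuantumFieldTheory.Balaban1983to89.B5Prop11Plancherel (Tor fine shiftM fdiff unitVec calG Cst opNorm_calG_le opNorm_fdiff_calG_le calG_isHermitian)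
open Literature.MathematicalPhysics.QuantumFieldTheory.Balaban1983to89.B5Prop11Lower (nsq nsq_nonneg)
open Literature.MathematicalPhysics.QuantumFieldTheory.Balaban1983to89.B5G183FreeRowSum (shiftM_mulVec)
open Literature.MathematicalPhysics.QuantumFieldTheory.Balaban1983to89.B5G183RateUnitTower (lev)
open Summit.QuantumFields.BalabanUV.T4Continuum.BalabanAveragedTowerUnit (idx calGlev one_le_lev' cast_lev')
open Summit.QuantumFields.BalabanUV.T4Continuum.ScalarAveragedPropagator (opNorm_le_of_nsq_le_rect)
open Summit.QuantumFields.BalabanUV.T4Continuum.GaugeTermCoercivity (nsq_mulVec_le_rect)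

/-! ## §1 The abstract slab inequality along the orbits of a permutation -/

section Abstract

variable {X : Type*} [Fintype X] [DecidableEq X]

omit [Fintype X] [DecidableEq X] in
/-- telescoping along the orbit: `‖u w‖² ≤ ‖u(σ^t w)‖² + Σ_{s<t} |‖u(σ^{s+1}w)‖² − ‖u(σ^s w)‖²|`. [folklore] -/
theorem normSq_le_orbit (σ : Equiv.Perm X) (u : X → ℂ) (w : X) : ∀ t : ℕ,
    ‖u w‖ ^ 2 ≤ ‖u ((σ ^ t) w)‖ ^ 2 + ∑ s ∈ range t, |‖u (σ ((σ ^ s) w))‖ ^ 2 - ‖u ((σ ^ s) w)‖ ^ 2|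
  | 0 => by simp
  | t + 1 => by
      have ih := normSq_le_orbit σ u w t
      rw [sum_range_succ, pow_succ' σ t, Equiv.Perm.mul_apply]
      linarith [neg_abs_le (‖u (σ ((σ ^ t) w))‖ ^ 2 - ‖u ((σ ^ t) w)‖ ^ 2)]

omit [Fintype X] [DecidableEq X] in
/-- averaging the telescoping bound over `t < N`: `‖u w‖² ≤ (Σ_{t<N} ‖u(σ^t w)‖²)∕N + Σ_{s<N} |‖u(σ^{s+1}w)‖² − ‖u(σ^s w)‖²|`. [folklore] -/
theorem normSq_le_avg_orbit (σ : Equiv.Perm X) (u : X → ℂ) (w : X) {N : ℕ} (hN : 0 < N) :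
    ‖u w‖ ^ 2 ≤ (∑ t ∈ range N, ‖u ((σ ^ t) w)‖ ^ 2) / N + ∑ s ∈ range N, |‖u (σ ((σ ^ s) w))‖ ^ 2 - ‖u ((σ ^ s) w)‖ ^ 2| := by
  set G : ℝ := ∑ s ∈ range N, |‖u (σ ((σ ^ s) w))‖ ^ 2 - ‖u ((σ ^ s) w)‖ ^ 2| with hG
  have hN' : (0 : ℝ) < N := by exact_mod_cast hN
  have h : ∀ t ∈ range N, ‖u w‖ ^ 2 ≤ ‖u ((σ ^ t) w)‖ ^ 2 + G := by
    intro t ht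
    refine (normSq_le_orbit σ u w t).trans (add_le_add le_rfl ?_)
    exact sum_le_sum_of_subset_of_nonneg (range_subset_range.2 (mem_range.1 ht).le) fun _ _ _ => abs_nonneg _
  have hsum := sum_le_sum h
  rw [sum_const, card_range, sum_add_distrib, sum_const, card_range] at hsum
  simp only [nsmul_eq_mul] at hsum
  rw [div_add' _ _ _ hN'.ne', le_div_iff₀ hN']
  linarith

/-- exchange of summations under the orbit count: if every point is hit by at most `m` of the translates `σ^{−t}`, `t < N`, of `S`, then
`Σ_{w∈S} Σ_{t<N} h(σ^t w) ≤ m·Σ_v h v` for `h ≥ 0`. [folklore] -/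
theorem sum_slab_orbit_le (σ : Equiv.Perm X) (S : Finset X) {N m : ℕ}
    (hS : ∀ v : X, ((range N).filter (fun t => (σ ^ t).symm v ∈ S)).card ≤ m) {h : X → ℝ} (hh : ∀ v, 0 ≤ h v) :
    ∑ w ∈ S, ∑ t ∈ range N, h ((σ ^ t) w) ≤ m * ∑ v, h v := by
  calc ∑ w ∈ S, ∑ t ∈ range N, h ((σ ^ t) w) = ∑ t ∈ range N, ∑ w ∈ S, h ((σ ^ t) w) := sum_comm
    _ = ∑ t ∈ range N, ∑ v ∈ univ.filter (fun v => (σ ^ t).symm v ∈ S), h v := by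
        refine sum_congr rfl fun t _ => ?_
        exact sum_equiv (σ ^ t) (fun i => by simp) (fun i _ => rfl)
    _ = ∑ t ∈ range N, ∑ v, (if (σ ^ t).symm v ∈ S then h v else 0) := by
        refine sum_congr rfl fun t _ => ?_
        rw [sum_filter]
    _ = ∑ v, ∑ t ∈ range N, (if (σ ^ t).symm v ∈ S then h v else 0) := sum_comm
    _ = ∑ v, (((range N).filter (fun t => (σ ^ t).symm v ∈ S)).card : ℝ) * h v := by
        refine sum_congr rfl fun v _ => ?_
        rw [← sum_filter, sum_const, nsmul_eq_mul]
    _ ≤ ∑ v, (m : ℝ) * h v := sum_le_sum fun v _ => mul_le_mul_of_nonneg_right (by exact_mod_cast hS v) (hh v)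
    _ = m * ∑ v, h v := by rw [mul_sum]

omit [Fintype X] [DecidableEq X] in
/-- Cauchy–Schwarz for nonnegative real families: `Σ f·g ≤ √(Σ f²)·√(Σ g²)`. [folklore] -/
theorem sum_mul_le_sqrt_mul_sqrt (s : Finset X) (f g : X → ℝ) (hf : ∀ i, 0 ≤ f i) (hg : ∀ i, 0 ≤ g i) :
    ∑ i ∈ s, f i * g i ≤ Real.sqrt (∑ i ∈ s, f i ^ 2) * Real.sqrt (∑ i ∈ s, g i ^ 2) := by
  rw [← Real.sqrt_mul (sum_nonneg fun i _ => sq_nonneg (f i)),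
    ← Real.sqrt_sq (sum_nonneg fun i _ => mul_nonneg (hf i) (hg i))]
  exact Real.sqrt_le_sqrt (sum_mul_sq_le_sq_mul_sq s f g)

omit [DecidableEq X] in
/-- the total variation of `|u|²` along `σ` is controlled by the increment: `Σ_v |‖u(σv)‖² − ‖u v‖²| ≤ 2·√(Σ‖u(σv) − u v‖²)·√(Σ‖u v‖²)`. [folklore] -/
theorem sum_abs_normSq_sub_le (σ : Equiv.Perm X) (u : X → ℂ) :
    ∑ v, |‖u (σ v)‖ ^ 2 - ‖u v‖ ^ 2| ≤ 2 * Real.sqrt (∑ v, ‖u (σ v) - u v‖ ^ 2) * Real.sqrt (∑ v, ‖u v‖ ^ 2) := by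
  have h1 : ∀ v, |‖u (σ v)‖ ^ 2 - ‖u v‖ ^ 2| ≤ ‖u (σ v) - u v‖ * ‖u (σ v)‖ + ‖u (σ v) - u v‖ * ‖u v‖ := by
    intro v
    rw [sq_sub_sq, abs_mul, abs_of_nonneg (by positivity : (0 : ℝ) ≤ ‖u (σ v)‖ + ‖u v‖)]
    have hb : |‖u (σ v)‖ - ‖u v‖| ≤ ‖u (σ v) - u v‖ := abs_norm_sub_norm_le _ _
    nlinarith [norm_nonneg (u (σ v)), norm_nonneg (u v), norm_nonneg (u (σ v) - u v), abs_nonneg (‖u (σ v)‖ - ‖u v‖)]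
  refine (sum_le_sum fun v _ => h1 v).trans ?_
  rw [sum_add_distrib]
  have cs1 := sum_mul_le_sqrt_mul_sqrt univ (fun v => ‖u (σ v) - u v‖) (fun v => ‖u (σ v)‖) (fun _ => norm_nonneg _) (fun _ => norm_nonneg _)
  have cs2 := sum_mul_le_sqrt_mul_sqrt univ (fun v => ‖u (σ v) - u v‖) (fun v => ‖u v‖) (fun _ => norm_nonneg _) (fun _ => norm_nonneg _)
  have e : ∑ v, ‖u (σ v)‖ ^ 2 = ∑ v, ‖u v‖ ^ 2 := Equiv.sum_comp σ (fun v => ‖u v‖ ^ 2)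
  rw [e] at cs1
  linarith

/-- **`sum_slab_normSq_le` — THE ABSTRACT SLAB INEQUALITY** [our proof]: if every point is hit by at most `m` of the translates `σ^{−t}S`, `t < N` (`N ≥ 1`), then for every
`u : X → ℂ`: `Σ_{w∈S} ‖u w‖² ≤ m·(Σ_v‖u v‖²∕N + 2·√(Σ_v‖u(σv) − u v‖²)·√(Σ_v‖u v‖²))` — a function with small increments along `σ` cannot concentrate on a thin transversal. -/
theorem sum_slab_normSq_le (σ : Equiv.Perm X) (S : Finset X) {N m : ℕ} (hN : 0 < N)
    (hS : ∀ v : X, ((range N).filter (fun t => (σ ^ t).symm v ∈ S)).card ≤ m) (u : X → ℂ) :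
    ∑ w ∈ S, ‖u w‖ ^ 2 ≤ m * ((∑ v, ‖u v‖ ^ 2) / N + 2 * Real.sqrt (∑ v, ‖u (σ v) - u v‖ ^ 2) * Real.sqrt (∑ v, ‖u v‖ ^ 2)) := by
  have step1 : ∑ w ∈ S, ‖u w‖ ^ 2
      ≤ ∑ w ∈ S, ((∑ t ∈ range N, ‖u ((σ ^ t) w)‖ ^ 2) / N + ∑ s ∈ range N, |‖u (σ ((σ ^ s) w))‖ ^ 2 - ‖u ((σ ^ s) w)‖ ^ 2|) :=
    sum_le_sum fun w _ => normSq_le_avg_orbit σ u w hN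
  rw [sum_add_distrib, ← sum_div] at step1
  have c1 := sum_slab_orbit_le σ S hS (h := fun v => ‖u v‖ ^ 2) (fun v => sq_nonneg _)
  have c2 := sum_slab_orbit_le σ S hS (h := fun v => |‖u (σ v)‖ ^ 2 - ‖u v‖ ^ 2|) (fun v => abs_nonneg _)
  have c3 := sum_abs_normSq_sub_le σ u
  beta_reduce at c1 c2
  have hm : (0 : ℝ) ≤ m := Nat.cast_nonneg m
  calc ∑ w ∈ S, ‖u w‖ ^ 2
      ≤ (∑ w ∈ S, ∑ t ∈ range N, ‖u ((σ ^ t) w)‖ ^ 2) / N + ∑ w ∈ S, ∑ s ∈ range N, |‖u (σ ((σ ^ s) w))‖ ^ 2 - ‖u ((σ ^ s) w)‖ ^ 2| := step1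
    _ ≤ (m * ∑ v, ‖u v‖ ^ 2) / N + m * (2 * Real.sqrt (∑ v, ‖u (σ v) - u v‖ ^ 2) * Real.sqrt (∑ v, ‖u v‖ ^ 2)) :=
        add_le_add (div_le_div_of_nonneg_right c1 (Nat.cast_nonneg N)) (c2.trans (mul_le_mul_of_nonneg_left c3 hm))
    _ = _ := by ring

end Abstract

/-! ## §2 The coordinate slab of a torus of vector fields -/

section Torus

variable {d : ℕ} (N : Fin d → ℕ) [hN : ∀ μ, NeZero (N μ)]

omit hN in
/-- the translation by `e_ν` on (sites × components) as a permutation. [folklore] -/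
theorem prodShift_apply (ν : Fin d) (w : Tor N × Fin d) :
    (Equiv.prodCongr (Equiv.addRight (unitVec N ν)) (Equiv.refl (Fin d))) w = (w.1 + unitVec N ν, w.2) := rfl

omit hN in
/-- the iterated translation: `σ^t (x, i) = (x + t•e_ν, i)`. [folklore] -/
theorem prodShift_pow_apply (ν : Fin d) : ∀ (t : ℕ) (w : Tor N × Fin d),
    ((Equiv.prodCongr (Equiv.addRight (unitVec N ν)) (Equiv.refl (Fin d))) ^ t) w = (w.1 + t • unitVec N ν, w.2)
  | 0, w => by simp
  | t + 1, w => by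
      rw [pow_succ', Equiv.Perm.mul_apply, prodShift_pow_apply ν t w, prodShift_apply]
      simp only [add_smul, one_smul, add_assoc]

omit hN in
/-- the inverse iterated translation: `σ^{−t} (x, i) = (x − t•e_ν, i)`. [folklore] -/
theorem prodShift_pow_symm_apply (ν : Fin d) (t : ℕ) (v : Tor N × Fin d) :
    ((Equiv.prodCongr (Equiv.addRight (unitVec N ν)) (Equiv.refl (Fin d))) ^ t).symm v = (v.1 - t • unitVec N ν, v.2) := by
  rw [Equiv.symm_apply_eq, prodShift_pow_apply]
  simp

omit hN in
/-- the `ν`-coordinate of `x − t•e_ν` is `x_ν − t`. [folklore] -/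
theorem sub_smul_unitVec_apply (ν : Fin d) (x : Tor N) (t : ℕ) : (x - t • unitVec N ν) ν = x ν - (t : ZMod (N ν)) := by
  simp [unitVec]

/-- **`card_filter_shift_mem`** — the orbit count of a coordinate slab: `#{t < N_ν : σ^{−t}v ∈ {w : w₁(ν) ∈ A}} = #A`. [folklore] -/
theorem card_filter_shift_mem (ν : Fin d) (A : Finset (ZMod (N ν))) (v : Tor N × Fin d) :
    ((range (N ν)).filter (fun t => (((Equiv.prodCongr (Equiv.addRight (unitVec N ν)) (Equiv.refl (Fin d))) ^ t).symm v) ∈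
      univ.filter (fun w : Tor N × Fin d => w.1 ν ∈ A))).card = A.card := by
  have e : (range (N ν)).filter (fun t => (((Equiv.prodCongr (Equiv.addRight (unitVec N ν)) (Equiv.refl (Fin d))) ^ t).symm v) ∈
      univ.filter (fun w : Tor N × Fin d => w.1 ν ∈ A)) = A.image (fun a => (v.1 ν - a).val) := by
    ext t
    simp only [mem_filter, mem_range, mem_univ, true_and, mem_image, prodShift_pow_symm_apply, sub_smul_unitVec_apply]
    constructor
    · rintro ⟨ht, hA⟩
      refine ⟨v.1 ν - (t : ZMod (N ν)), hA, ?_⟩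
      rw [sub_sub_cancel, ZMod.val_natCast_of_lt ht]
    · rintro ⟨a, ha, rfl⟩
      refine ⟨ZMod.val_lt _, ?_⟩
      rw [ZMod.natCast_zmod_val, sub_sub_cancel]
      exact ha
  rw [e, card_image_of_injective]
  intro a b hab
  have := ZMod.val_injective (N ν) hab
  simpa using this

/-- **`nsq_slab_le` — THE SLAB INEQUALITY ON THE TORUS OF VECTOR FIELDS** [our proof]: for `u : Tor N × Fin d → ℂ`, a direction `ν` and a set `A` of residues mod `N_ν`,
`Σ_{w : w₁(ν) ∈ A} ‖u w‖² ≤ #A·(nsq u∕N_ν + 2·√(nsq (S_νu − u))·√(nsq u))`. -/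
theorem nsq_slab_le (ν : Fin d) (A : Finset (ZMod (N ν))) (u : Tor N × Fin d → ℂ) :
    ∑ w ∈ univ.filter (fun w : Tor N × Fin d => w.1 ν ∈ A), ‖u w‖ ^ 2
      ≤ A.card * (nsq u / (N ν) + 2 * Real.sqrt (nsq (shiftM N ν *ᵥ u - u)) * Real.sqrt (nsq u)) := by
  have hN0 : 0 < N ν := Nat.pos_of_ne_zero (NeZero.ne _)
  have h := sum_slab_normSq_le (Equiv.prodCongr (Equiv.addRight (unitVec N ν)) (Equiv.refl (Fin d))) (univ.filter (fun w : Tor N × Fin d => w.1 ν ∈ A))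
    (m := A.card) hN0 (fun v => (card_filter_shift_mem N ν A v).le) u
  have e : ∑ v, ‖u ((Equiv.prodCongr (Equiv.addRight (unitVec N ν)) (Equiv.refl (Fin d))) v) - u v‖ ^ 2 = nsq (shiftM N ν *ᵥ u - u) := by
    unfold nsq
    refine sum_congr rfl fun v _ => ?_
    rw [Pi.sub_apply, shiftM_mulVec, prodShift_apply]
  rw [e] at h
  exact h

end Torus

/-! ## §3 The smoothing bound for Bałaban's propagator `𝒢` of (1.83) ∕ (1.89) -/

section Propagator

variable {d : ℕ} (n : ℕ) [NeZero n] (hn : 1 ≤ n) (M : Fin d → ℕ) [hM : ∀ μ, NeZero (M μ)] (a : ℝ) (ha : 0 < a)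

omit hM in
/-- `S_ν − 1 = n⁻¹•∇_ν` on the lattice of spacing `η = n⁻¹` (`fdiff = n•(S_ν − 1)`). [cite: Balaban1984PropagatorsI, (1.31) p.23] [folklore] -/
theorem shiftM_sub_one_eq (ν : Fin d) : shiftM (fine n M) ν - 1 = ((n : ℂ))⁻¹ • fdiff (fine n M) (n : ℂ) ν := by
  have hn0 : (n : ℂ) ≠ 0 := by exact_mod_cast NeZero.ne n
  rw [fdiff, smul_smul, inv_mul_cancel₀ hn0, one_smul]

/-- the increment of `u = 𝒢g` along `ν`: `nsq (S_ν(𝒢g) − 𝒢g) ≤ (Cst∕n)²·nsq g`. [cite: Balaban1984PropagatorsI, Prop. 1.1 (1.89) p.33] -/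
theorem nsq_shift_calG_sub_le (ν : Fin d) (g : Tor (fine n M) × Fin d → ℂ) :
    nsq (shiftM (fine n M) ν *ᵥ (calG n hn M a ha *ᵥ g) - calG n hn M a ha *ᵥ g) ≤ (Cst d a / n) ^ 2 * nsq g := by
  have hn0 : (0 : ℝ) < n := by exact_mod_cast Nat.pos_of_ne_zero (NeZero.ne n)
  have e : shiftM (fine n M) ν *ᵥ (calG n hn M a ha *ᵥ g) - calG n hn M a ha *ᵥ g
      = (((n : ℂ))⁻¹ • (fdiff (fine n M) (n : ℂ) ν * calG n hn M a ha)) *ᵥ g := by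
    rw [← Matrix.smul_mul, ← shiftM_sub_one_eq, Matrix.sub_mul, Matrix.one_mul, Matrix.sub_mulVec, ← Matrix.mulVec_mulVec]
  rw [e]
  refine (nsq_mulVec_le_rect _ g).trans (mul_le_mul_of_nonneg_right ?_ (nsq_nonneg g))
  have h1 : ‖((n : ℂ))⁻¹ • (fdiff (fine n M) (n : ℂ) ν * calG n hn M a ha)‖ ≤ Cst d a / n := by
    rw [norm_smul, norm_inv, Complex.norm_natCast, div_eq_inv_mul]
    exact mul_le_mul_of_nonneg_left (opNorm_fdiff_calG_le n hn M a ha ν) (inv_nonneg.mpr hn0.le)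
  exact pow_le_pow_left₀ (norm_nonneg _) h1 2

/-- **`opNorm_slab_mul_calG_le` — A MASSIVE PROPAGATOR SMOOTHS SHEETS** [our proof]: for every direction `ν` and every set `A` of residues mod `n·M_ν` (a union of `#A` fine layers
transverse to `ν`), `‖𝟙_A·𝒢‖ ≤ Cst(d,a)·√(3·#A∕n)` where `𝟙_A = diagonal [w₁(ν) ∈ A]` — from (1.89)'s `‖𝒢‖, ‖∇_ν𝒢‖ ≤ Cst` and §2 (`N_ν = n·M_ν ≥ n`). [cite:
Balaban1984PropagatorsI, Prop. 1.1 (1.89) p.33] -/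
theorem opNorm_slab_mul_calG_le (ν : Fin d) (A : Finset (ZMod (fine n M ν))) :
    ‖Matrix.diagonal (fun w : Tor (fine n M) × Fin d => if w.1 ν ∈ A then (1 : ℂ) else 0) * calG n hn M a ha‖
      ≤ Cst d a * Real.sqrt (3 * A.card / n) := by
  have hn0 : (0 : ℝ) < n := by exact_mod_cast Nat.pos_of_ne_zero (NeZero.ne n)
  have hC : 0 ≤ Cst d a := (norm_nonneg _).trans (opNorm_calG_le n hn M a ha)
  have hNν : (n : ℝ) ≤ (fine n M ν : ℕ) := by
    have h1 : 1 ≤ M ν := Nat.pos_of_ne_zero (NeZero.ne _)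
    have : n * 1 ≤ n * M ν := Nat.mul_le_mul_left n h1
    exact_mod_cast (by simpa using this : n ≤ n * M ν)
  refine opNorm_le_of_nsq_le_rect _ (mul_nonneg hC (Real.sqrt_nonneg _)) fun g => ?_
  set u := calG n hn M a ha *ᵥ g with hu
  -- the left side is the slab mass of `u = 𝒢g`
  have e1 : nsq ((Matrix.diagonal (fun w : Tor (fine n M) × Fin d => if w.1 ν ∈ A then (1 : ℂ) else 0) * calG n hn M a ha) *ᵥ g)
      = ∑ w ∈ univ.filter (fun w : Tor (fine n M) × Fin d => w.1 ν ∈ A), ‖u w‖ ^ 2 := by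
    rw [← Matrix.mulVec_mulVec, ← hu]
    unfold nsq
    simp only [Matrix.mulVec_diagonal]
    rw [sum_filter]
    refine sum_congr rfl fun w _ => ?_
    split_ifs <;> simp
  rw [e1]
  have hu1 : nsq u ≤ Cst d a ^ 2 * nsq g :=
    (nsq_mulVec_le_rect _ g).trans (mul_le_mul_of_nonneg_right (pow_le_pow_left₀ (norm_nonneg _) (opNorm_calG_le n hn M a ha) 2) (nsq_nonneg g))
  have hu2 := nsq_shift_calG_sub_le n hn M a ha ν g
  have hg0 := nsq_nonneg g
  have s1 : Real.sqrt (nsq u) ≤ Cst d a * Real.sqrt (nsq g) := by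
    rw [← Real.sqrt_sq hC, ← Real.sqrt_mul (sq_nonneg _)]
    exact Real.sqrt_le_sqrt hu1
  have s2 : Real.sqrt (nsq (shiftM (fine n M) ν *ᵥ u - u)) ≤ (Cst d a / n) * Real.sqrt (nsq g) := by
    rw [← Real.sqrt_sq (div_nonneg hC hn0.le), ← Real.sqrt_mul (sq_nonneg _)]
    exact Real.sqrt_le_sqrt hu2
  have h := nsq_slab_le (fine n M) ν A u
  have hA : (0 : ℝ) ≤ A.card := Nat.cast_nonneg _
  have hNpos : (0 : ℝ) < (fine n M ν : ℕ) := lt_of_lt_of_le hn0 hNν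
  -- assemble: `Σ_slab ≤ #A·(Cst²∕N_ν + 2(Cst∕n)Cst)·nsq g ≤ Cst²·(3#A∕n)·nsq g`
  have t1 : nsq u / (fine n M ν : ℕ) ≤ Cst d a ^ 2 * nsq g / n :=
    calc nsq u / (fine n M ν : ℕ) ≤ nsq u / n := div_le_div_of_nonneg_left (nsq_nonneg u) hn0 hNν
      _ ≤ Cst d a ^ 2 * nsq g / n := div_le_div_of_nonneg_right hu1 hn0.le
  have t2 : 2 * Real.sqrt (nsq (shiftM (fine n M) ν *ᵥ u - u)) * Real.sqrt (nsq u) ≤ 2 * ((Cst d a / n) * Real.sqrt (nsq g)) * (Cst d a * Real.sqrt (nsq g)) :=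
    mul_le_mul (mul_le_mul_of_nonneg_left s2 zero_le_two) s1 (Real.sqrt_nonneg _) (by positivity)
  have t3 : Real.sqrt (nsq g) * Real.sqrt (nsq g) = nsq g := Real.mul_self_sqrt hg0
  calc ∑ w ∈ univ.filter (fun w : Tor (fine n M) × Fin d => w.1 ν ∈ A), ‖u w‖ ^ 2
      ≤ A.card * (nsq u / (fine n M ν : ℕ) + 2 * Real.sqrt (nsq (shiftM (fine n M) ν *ᵥ u - u)) * Real.sqrt (nsq u)) := h
    _ ≤ A.card * (Cst d a ^ 2 * nsq g / n + 2 * ((Cst d a / n) * Real.sqrt (nsq g)) * (Cst d a * Real.sqrt (nsq g))) :=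
        mul_le_mul_of_nonneg_left (add_le_add t1 t2) hA
    _ = (Cst d a * Real.sqrt (3 * A.card / n)) ^ 2 * nsq g := by
        rw [mul_pow, Real.sq_sqrt (by positivity)]
        have e3 : 2 * ((Cst d a / n) * Real.sqrt (nsq g)) * (Cst d a * Real.sqrt (nsq g)) = 2 * Cst d a ^ 2 * nsq g / n := by
          calc 2 * ((Cst d a / n) * Real.sqrt (nsq g)) * (Cst d a * Real.sqrt (nsq g))
              = 2 * Cst d a ^ 2 * (Real.sqrt (nsq g) * Real.sqrt (nsq g)) / n := by ring
            _ = 2 * Cst d a ^ 2 * nsq g / n := by rw [t3]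
        rw [e3]; field_simp; ring

/-- **`opNorm_calG_mul_slab_le`** — the same bound for `𝒢·𝟙_A` (`𝒢ᴴ = 𝒢`, `𝟙_Aᴴ = 𝟙_A`). [cite: Balaban1984PropagatorsI, Prop. 1.1 (1.89) p.33] -/
theorem opNorm_calG_mul_slab_le (ν : Fin d) (A : Finset (ZMod (fine n M ν))) :
    ‖calG n hn M a ha * Matrix.diagonal (fun w : Tor (fine n M) × Fin d => if w.1 ν ∈ A then (1 : ℂ) else 0)‖
      ≤ Cst d a * Real.sqrt (3 * A.card / n) := by
  have hD : (Matrix.diagonal (fun w : Tor (fine n M) × Fin d => if w.1 ν ∈ A then (1 : ℂ) else 0))ᴴ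
      = Matrix.diagonal (fun w : Tor (fine n M) × Fin d => if w.1 ν ∈ A then (1 : ℂ) else 0) := by
    rw [Matrix.diagonal_conjTranspose]
    congr 1; funext w; by_cases h : w.1 ν ∈ A <;> simp [h]
  have e : calG n hn M a ha * Matrix.diagonal (fun w : Tor (fine n M) × Fin d => if w.1 ν ∈ A then (1 : ℂ) else 0)
      = (Matrix.diagonal (fun w : Tor (fine n M) × Fin d => if w.1 ν ∈ A then (1 : ℂ) else 0) * calG n hn M a ha)ᴴ := by
    rw [Matrix.conjTranspose_mul, hD, (calG_isHermitian n hn M a ha).eq]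
  rw [e, Matrix.l2_opNorm_conjTranspose]
  exact opNorm_slab_mul_calG_le n hn M a ha ν A

end Propagator

/-! ## §4 Tower reading: geometric at ratio `√(L⁻¹)` -/

section Tower

variable {d : ℕ} (L : ℕ) [NeZero L] (M : Fin d → ℕ) [hM : ∀ μ, NeZero (M μ)] (a : ℝ) (ha : 0 < a)

/-- **`opNorm_calGlev_mul_slab_le` — ALONG THE TOWER**: `‖𝒢_k·𝟙_A‖ ≤ Cst(d,a)·√(3·#A)·(√(L⁻¹))^k` for every slab `A` of residues mod `n_k·M_ν` (`n_k = L^k`). [cite: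
Balaban1984PropagatorsI, Prop. 1.1 (1.89) p.33] -/
theorem opNorm_calGlev_mul_slab_le (k : ℕ) (ν : Fin d) (A : Finset (ZMod (fine (lev L k) M ν))) :
    ‖calGlev L M a ha k * Matrix.diagonal (fun w : idx L M k => if w.1 ν ∈ A then (1 : ℂ) else 0)‖
      ≤ Cst d a * Real.sqrt (3 * A.card) * Real.sqrt ((L : ℝ)⁻¹) ^ k := by
  have h := opNorm_calG_mul_slab_le (lev L k) (one_le_lev' L k) M a ha ν A
  have hL : (0 : ℝ) ≤ (L : ℝ)⁻¹ := inv_nonneg.mpr (Nat.cast_nonneg L)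
  have e2 : Real.sqrt (((L : ℝ)⁻¹) ^ k) = Real.sqrt ((L : ℝ)⁻¹) ^ k := by
    rw [← Real.sqrt_sq (pow_nonneg (Real.sqrt_nonneg _) k), ← pow_mul, mul_comm, pow_mul, Real.sq_sqrt hL]
  have e : Real.sqrt (3 * A.card / (lev L k : ℕ)) = Real.sqrt (3 * A.card) * Real.sqrt ((L : ℝ)⁻¹) ^ k := by
    rw [cast_lev', div_eq_mul_inv, ← inv_pow, Real.sqrt_mul (by positivity), e2]
  rw [e, ← mul_assoc] at h
  exact h

end Tower

end Summit.QuantumFields.BalabanUV.Beta.GAN24.SlabSmoothingBound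

end
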